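import Summits.CriticalPhenomena.PercolationContinuityZ3.Theorems.SoloBlindKNUniformCoefficients

/-!
# Kozma–Nitzan's Questions 7 and 8: the explicit single-target candidates

[KozmaNitzan2024, §5.5 "Candidates", p. 36] asks for WHICH target `a ∈ A` the pre-FKG inequality
(41) `P(o ↔ b, o ↔ A) ≥ P(o ↔ A, a ↔ b)` holds, beyond the minimiser of the right-hand side, and proposes
three explicit candidates; we type the first two:

* `KNQuestion7 w A o` — (41) holds at every `b` for every minimiser `a` of `P(a ↔ b)` over `A`
  ("does the minimiser of the post-FKG version also satisfy the pre-FKG version?");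
* `KNQuestion8 w A o` — (41) holds at every `b` for every minimiser `a` of `P(a ↔ b, o ↮ A)` over `A`.

Both imply Kozma–Nitzan's Conjecture 2 at `(G, A, o)` for every `b` (`knConj2All_of_question7`,
`knConj2All_of_question8`): a minimiser exists since `A` is finite and non-empty, and
`P(o ↔ b, o ↔ A) ≤ P(o ↔ b)`.

Numerical status (this programme, exact rational arithmetic on ≈ 43 000 weighted graphs with `n ≤ 9`,
`|A| ≤ 5`, 259 185 triples `(o, A, b)`, including near-singular and boundary-layer families, plus weight
hill-climbs): no violation of Question 7, 8 or 9 was found, with or without ties — in contrast with the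
Theorem-11 coefficient candidates for Question 5, which fail on explicit instances.  Kozma–Nitzan report
numerical evidence too but are "rather hesitant" (p. 36).  Elementary; no sorry, no new axioms.
[cite: KozmaNitzan2024, Questions 7–8 (p. 36), Conjecture 2 (p. 3)]
-/

noncomputable section

open MeasureTheory Set Finset
open scoped BigOperators
open Literature.Probability.LatticeModels (prodBernoulli)
open Literature.Probability.Percolation

namespace Summit.CriticalPhenomena.PercolationContinuityZ3.Theorems.SoloBlindKN

section Percolation

variable {V : Type*} [Fintype V] [DecidableEq V]

/-- **Kozma–Nitzan's Question 7 at `(G, A, o)`** (p. 36): for every `b` and every `a ∈ A` minimising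
`P(a ↔ b)` over `A`, the pre-FKG inequality (41) `P(o ↔ A, a ↔ b) ≤ P(o ↔ b, o ↔ A)` holds.
[cite: KozmaNitzan2024, Question 7 (p. 36)] -/
def KNQuestion7 (w : Sym2 V → unitInterval) (A : Finset V) (o : V) : Prop :=
  ∀ b : V, ∀ a ∈ A,
    (∀ a' ∈ A, (prodBernoulli w).real (openConn a b) ≤ (prodBernoulli w).real (openConn a' b)) →
      (prodBernoulli w).real (openConn a b ∩ connTo o A) ≤
        (prodBernoulli w).real (openConn o b ∩ connTo o A)

/-- **Kozma–Nitzan's Question 8 at `(G, A, o)`** (p. 36): for every `b` and every `a ∈ A` minimising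
`P(a ↔ b, o ↮ A)` over `A`, the pre-FKG inequality (41) holds.
[cite: KozmaNitzan2024, Question 8 (p. 36)] -/
def KNQuestion8 (w : Sym2 V → unitInterval) (A : Finset V) (o : V) : Prop :=
  ∀ b : V, ∀ a ∈ A,
    (∀ a' ∈ A, (prodBernoulli w).real (openConn a b \ connTo o A) ≤
      (prodBernoulli w).real (openConn a' b \ connTo o A)) →
      (prodBernoulli w).real (openConn a b ∩ connTo o A) ≤
        (prodBernoulli w).real (openConn o b ∩ connTo o A)

omit [Fintype V] [DecidableEq V] in
/-- From (41) at some target to Conjecture 2 at `b`: `P(o ↔ b, o ↔ A) ≤ P(o ↔ b)`. -/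
theorem knConj2_at_of_preFKG (w : Sym2 V → unitInterval) (A : Finset V) (o b a : V) (ha : a ∈ A)
    (h : (prodBernoulli w).real (openConn a b ∩ connTo o A) ≤
      (prodBernoulli w).real (openConn o b ∩ connTo o A)) :
    ∃ a ∈ A, (prodBernoulli w).real (openConn a b ∩ connTo o A) ≤
      (prodBernoulli w).real (openConn o b) :=
  ⟨a, ha, h.trans (measureReal_mono (h₂ := measure_ne_top _ _) inter_subset_left)⟩

omit [Fintype V] [DecidableEq V] in
/-- **Question 7 implies Conjecture 2** at `(G, A, o)`, for every `b`, when `A` is non-empty: take a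
minimiser of `a ↦ P(a ↔ b)` over the finite set `A`. [cite: KozmaNitzan2024, Question 7 (p. 36)] -/
theorem knConj2All_of_question7 (w : Sym2 V → unitInterval) (A : Finset V) (o : V) (hA : A.Nonempty)
    (h : KNQuestion7 w A o) : KNConj2All w A o := by
  intro b
  obtain ⟨a, ha, hmin⟩ :=
    A.exists_min_image (fun a' => (prodBernoulli w).real (openConn a' b)) hA
  exact knConj2_at_of_preFKG w A o b a ha (h b a ha hmin)

omit [Fintype V] [DecidableEq V] in
/-- **Question 8 implies Conjecture 2** at `(G, A, o)`, for every `b`, when `A` is non-empty: take a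
minimiser of `a ↦ P(a ↔ b, o ↮ A)` over `A`. [cite: KozmaNitzan2024, Question 8 (p. 36)] -/
theorem knConj2All_of_question8 (w : Sym2 V → unitInterval) (A : Finset V) (o : V) (hA : A.Nonempty)
    (h : KNQuestion8 w A o) : KNConj2All w A o := by
  intro b
  obtain ⟨a, ha, hmin⟩ :=
    A.exists_min_image (fun a' => (prodBernoulli w).real (openConn a' b \ connTo o A)) hA
  exact knConj2_at_of_preFKG w A o b a ha (h b a ha hmin)

omit [Fintype V] [DecidableEq V] in
/-- For `|A| = 1` Question 7 holds outright: the only target is `a`, and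
`{a ↔ b} ∩ {o ↔ a} ⊆ {o ↔ b} ∩ {o ↔ a}` by transitivity of open connection. -/
theorem knQuestion7_singleton (w : Sym2 V → unitInterval) (o a : V) : KNQuestion7 w {a} o := by
  intro b a' ha' _
  rw [Finset.mem_singleton] at ha'
  subst ha'
  refine measureReal_mono (h₂ := measure_ne_top _ _) ?_
  intro ω hω
  have hconn : connTo o ({a'} : Finset V) = openConn (V := V) o a' := by
    simp [connTo]
  rw [hconn] at hω ⊢
  exact ⟨SimpleGraph.Reachable.trans hω.2 hω.1, hω.2⟩

end Percolation

end Summit.CriticalPhenomena.PercolationContinuityZ3.Theorems.SoloBlindKN
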